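import Literature.Analysis.FluidPDE.GalerkinEnergyBalanceLongTime
import Literature.Analysis.FluidPDE.ZerothLawProofs
import Summits.AnomalousDissipation.AnomalousDissipation.Theses.DecimationAxis
import HarnessLib

/-!
# Budget rules for the crux `DecimationAxis.GalerkinFloor` (stmt-AnomalousDissipation-1582):
# the registered Tools stub `stub_heartBudgetTools` of the line `birth` (STUB-PLAN Step 0′)

Route `AnomalousDissipation/DecimationAxis`, crux `GalerkinFloor`, skeleton `Cruxes/GalerkinFloor/Lines/birth.lean`
(sha b3793ea2…), heart stub `stub_uniformGalerkinAnomaly`; STUB-PLAN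
`Cruxes/GalerkinFloor/STUB-PLAN-stub_uniformGalerkinAnomaly.md`, §1.4 / §2 Step 0′ (N1, N2) and T8.

Design rules every witness of the heart stub must obey, in the skeleton's vocabulary (local notations
expanding to the skeleton's §0 bodies verbatim, as in the sibling Tools file
`DecimationAxisGalerkinFloorBalance.lean`; this file does not depend on it):

* `longTimeAvgInf_coeffDissipation_le` — **floor vs ceiling**: on `S ⊆ freqBall K` (punctured,
  symmetric), `⟨D⟩⁻ ≤ ν·4π²K²·⟨E⟩⁺` (truncation ceiling T8 + boundedness of the means);
* `heart_budget_necessary` (N2) — a witness at one level `(ν, K)` with `⟨E⟩⁺ ≤ E`, `⟨D⟩⁻ ≥ ε` has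
  `ε ≤ ‖g‖_{ℓ²(freqBall N)} √E` (energy row) and `ε ≤ 4π²K²·ν·E` (ceiling), so any heart family needs
  `K₀(j)² ≥ ε/(4π²ν_j E)`;
* `not_heart_with_uniform_threshold` (N1) — the `∃ K₀ ∀ j` strengthening of the heart stub is FALSE
  for every force: at `K = K₀`, `ε ≤ 4π²K₀²ν_j E → 0`;
* the registered conjunction `stub_heartBudgetTools` (T8 ∧ floor-vs-ceiling ∧ N2 ∧ N1).

Sources: folklore (ConstantinFoias1988 Ch. 8; DoeringFoias2002 §2); the uniform-threshold negation is
`Cruxes/GalerkinFloor/Lines/fraction.lean` §4 / STUB-IDEAS k3 C1.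
-/

noncomputable section

-- D-0017: single-problem summit ⇒ the duplicated namespace segment is by design.
set_option linter.dupNamespace false

open Filter Set MeasureTheory
open scoped Topology
open Literature.Analysis.FunctionSpaces Literature.Analysis.FunctionSpaces.Torus
open Literature.Analysis.FluidPDE

namespace Summit.AnomalousDissipation.AnomalousDissipation.Theorems.DecimationAxisGalerkinFloor

/-- Lattice frequencies `ℤ³` (local notation, as in the skeleton). -/
local notation "ℤ³" => Fin 3 → ℤ
/-- Fourier coefficient values `ℂ³` (local notation, as in the skeleton). -/
local notation "ℂ³" => EuclideanSpace ℂ (Fin 3)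

set_option quotPrecheck false in
/-- The skeleton's `Birth.IsDesignerForce`, body verbatim (local notation). -/
local notation "IsDesignerForce" =>
  fun (N : ℕ) (g : ℤ³ → ℂ³) =>
    IsConjSymm g ∧ (∀ k, k ∉ freqBall N → g k = 0) ∧ g 0 = 0 ∧
      (∀ k : ℤ³, ∑ i, ((k i : ℤ) : ℂ) * g k i = 0)

set_option quotPrecheck false in
/-- The skeleton's `Birth.IsCoeffTrajectory`, body verbatim (local notation). -/
local notation "IsCoeffTrajectory" =>
  fun (S : Finset ℤ³) (ν : ℝ) (g : ℤ³ → ℂ³) (c : ℝ → ↥S → ℂ³) =>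
    (∀ t, c t ∈ galerkinSubspace S) ∧ ContinuousOn c (Set.Ici 0) ∧
      (∀ T : ℝ, ∀ t ∈ Set.Icc (0 : ℝ) T,
        HasDerivWithinAt c (galerkinRHS S ν (fun k => g k) (c t)) (Set.Icc 0 T) t)

set_option quotPrecheck false in
/-- The skeleton's `Birth.coeffEnergy`, body verbatim (local notation). -/
local notation "coeffEnergy" =>
  fun (c : ℝ → ↥(_ : Finset ℤ³) → ℂ³) (t : ℝ) => ∑ k, ‖c t k‖ ^ 2

set_option quotPrecheck false in
/-- The skeleton's `Birth.coeffDissipation`, body verbatim (local notation). -/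
local notation "coeffDissipation" =>
  fun (ν : ℝ) (c : ℝ → ↥(_ : Finset ℤ³) → ℂ³) (t : ℝ) =>
    ν * (4 * Real.pi ^ 2 * ∑ k : ↥(_ : Finset ℤ³), freqNormSq (k : ℤ³) * ‖c t k‖ ^ 2)

variable {S : Finset ℤ³} {ν : ℝ} {g : ℤ³ → ℂ³} {c : ℝ → ↥S → ℂ³}

/-! ## The punctured ball -/

/-- The punctured ball `freqBall K ∖ {0}` is symmetric under `k ↦ -k`. -/
theorem neg_mem_of_mem_erase_freqBall {K : ℕ} :
    ∀ k ∈ (freqBall K).erase (0 : ℤ³), -k ∈ (freqBall K).erase (0 : ℤ³) := by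
  intro k hk
  rw [Finset.mem_erase] at hk ⊢
  exact ⟨neg_ne_zero.2 hk.1, neg_mem_freqBall_of_mem k hk.2⟩

/-- The punctured ball does not contain the mean mode. -/
theorem zero_notMem_erase_freqBall {K : ℕ} : (0 : ℤ³) ∉ (freqBall K).erase (0 : ℤ³) :=
  Finset.notMem_erase 0 _

/-! ## Floor vs ceiling -/

/-- **Floor vs ceiling.** On a punctured symmetric `S ⊆ freqBall K`, `ν > 0`, real force:
`⟨D⟩⁻ ≤ ν·4π²K²·⟨E⟩⁺` — the `liminf`-mean of the total dissipation is at most the truncation ceiling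
times the `limsup`-mean of the energy (T8 pointwise; the means are bounded by the absorbing ball). -/
theorem longTimeAvgInf_coeffDissipation_le (hS : ∀ k ∈ S, -k ∈ S) (h0 : (0 : ℤ³) ∉ S) {K : ℕ}
    (hSK : S ⊆ freqBall K) (hν : 0 < ν) (hg : IsConjSymm g) (hc : IsCoeffTrajectory S ν g c) :
    longTimeAvgInf (coeffDissipation ν c) ≤
      ν * (4 * Real.pi ^ 2 * (K : ℝ) ^ 2) * longTimeAvgSup (coeffEnergy c) := by
  have hα : IsGalerkinODESolution ν (fun k : ↥S => g k) (c 0) c := ⟨rfl, hc.1, hc.2.1, hc.2.2⟩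
  have hgR : IsRealCoeff (fun k : ↥S => g k) := isRealCoeff_restrict hg
  have hC : 0 ≤ ν * (4 * Real.pi ^ 2 * (K : ℝ) ^ 2) := by positivity
  have h1 : longTimeAvgInf (coeffDissipation ν c) ≤ longTimeAvgSup (coeffDissipation ν c) :=
    liminf_le_limsup (hα.isBoundedUnder_le_timeMean_dissipation hν hS h0 hgR)
      (IsGalerkinODESolution.isBoundedUnder_ge_timeMean_dissipation hν.le c)
  have h2 : longTimeAvgSup (coeffDissipation ν c) ≤
      longTimeAvgSup (fun t => ν * (4 * Real.pi ^ 2 * (K : ℝ) ^ 2) * coeffEnergy c t) :=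
    longTimeAvgSup_mono (IsGalerkinODESolution.dissipation_nonneg hν.le c)
      (fun t => mul_nonneg hC (IsGalerkinODESolution.energy_nonneg c t))
      (fun T _ => (integrableOn_Ioc_of_continuousOn_Ici hα.continuousOn_energy T).const_mul _)
      (fun t _ => dissipation_le_of_subset_freqBall hSK hν.le (c t))
      (isBoundedUnder_timeMean_const_mul hC (hα.isBoundedUnder_le_timeMean_energy hν hS h0 hgR))
  rw [longTimeAvgSup_const_mul hC] at h2
  exact h1.trans h2

/-! ## N2 — necessary shape of any witness -/

/-- The `ℓ²` mass of a designer force on any finite set is at most its mass on `freqBall N`. -/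
theorem sum_norm_sq_le_sum_freqBall {N : ℕ} (hg : ∀ k, k ∉ freqBall N → g k = 0) (S : Finset ℤ³) :
    ∑ k ∈ S, ‖g k‖ ^ 2 ≤ ∑ k ∈ freqBall N, ‖g k‖ ^ 2 := by
  classical
  have h1 : ∑ k ∈ S, ‖g k‖ ^ 2 ≤ ∑ k ∈ S ∪ freqBall N, ‖g k‖ ^ 2 :=
    Finset.sum_le_sum_of_subset_of_nonneg Finset.subset_union_left fun k _ _ => sq_nonneg _
  have h2 : ∑ k ∈ freqBall N, ‖g k‖ ^ 2 = ∑ k ∈ S ∪ freqBall N, ‖g k‖ ^ 2 :=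
    Finset.sum_subset Finset.subset_union_right fun k _ hk => by rw [hg k hk, norm_zero]; ring
  rw [h2]
  exact h1

/-- **N2 (budgets of a witness are not free).** A trajectory of a designer force `(N, g)` at one level
`(ν, K)` on `S = freqBall K ∖ {0}` with `⟨E⟩⁺ ≤ E` and `⟨D⟩⁻ ≥ ε` obeys the energy row
`ε ≤ ‖g‖_{ℓ²(freqBall N)}·√E` and the truncation ceiling `ε ≤ 4π²K²·ν·E`
(so a heart family forces `K₀(j)² ≥ ε/(4π²ν_j E)`). -/
theorem heart_budget_necessary {N : ℕ} (hg : IsDesignerForce N g) (hν : 0 < ν) {K : ℕ}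
    (hS : S = (freqBall K).erase 0) (hc : IsCoeffTrajectory S ν g c) {E ε : ℝ}
    (hE : longTimeAvgSup (coeffEnergy c) ≤ E) (hε : ε ≤ longTimeAvgInf (coeffDissipation ν c)) :
    ε ≤ Real.sqrt (∑ k ∈ freqBall N, ‖g k‖ ^ 2) * Real.sqrt E ∧
      ε ≤ 4 * Real.pi ^ 2 * (K : ℝ) ^ 2 * ν * E := by
  subst hS
  have hsym := neg_mem_of_mem_erase_freqBall (K := K)
  have h0 := zero_notMem_erase_freqBall (K := K)
  have hα : IsGalerkinODESolution ν (fun k : ↥((freqBall K).erase 0) => g k) (c 0) c :=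
    ⟨rfl, hc.1, hc.2.1, hc.2.2⟩
  constructor
  · have h := hα.le_sqrt_mul_sqrt_of_floor hν hsym h0 (isRealCoeff_restrict hg.1) hE hε
    rw [Finset.sum_coe_sort ((freqBall K).erase 0) fun k => ‖g k‖ ^ 2] at h
    refine h.trans ?_
    exact mul_le_mul_of_nonneg_right (Real.sqrt_le_sqrt (sum_norm_sq_le_sum_freqBall hg.2.1 _))
      (Real.sqrt_nonneg E)
  · have h := longTimeAvgInf_coeffDissipation_le hsym h0 (Finset.erase_subset 0 (freqBall K)) hν
      hg.1 hc
    have hC : 0 ≤ ν * (4 * Real.pi ^ 2 * (K : ℝ) ^ 2) := by positivity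
    have h' := mul_le_mul_of_nonneg_left hE hC
    calc ε ≤ ν * (4 * Real.pi ^ 2 * (K : ℝ) ^ 2) * longTimeAvgSup (coeffEnergy c) := hε.trans h
      _ ≤ ν * (4 * Real.pi ^ 2 * (K : ℝ) ^ 2) * E := h'
      _ = 4 * Real.pi ^ 2 * (K : ℝ) ^ 2 * ν * E := by ring

/-! ## N1 — the uniform-threshold strengthening is false -/

/-- **N1.** The `K₀`-UNIFORM strengthening of the heart stub (`∃ K₀ ∀ j` instead of `∀ j ∃ K₀`) is false
for every force: at the fixed truncation `K = K₀` the ceiling gives `ε ≤ 4π²K₀²·ν_j·E` for all `j`, and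
`ν_j → 0`.  So in the heart `∀ j ∃ K₀` is load-bearing and `K₀(j)` must grow like the Kolmogorov
wavenumber. -/
theorem not_heart_with_uniform_threshold :
    ¬ ∃ (N : ℕ) (g : ℤ³ → ℂ³), IsDesignerForce N g ∧ ∃ (E ε : ℝ), 0 < ε ∧ ∃ ν : ℕ → ℝ,
      (∀ j, 0 < ν j) ∧ Tendsto ν atTop (nhds 0) ∧
      ∃ K₀ : ℕ, ∀ j, ∀ K, K₀ ≤ K → ∀ S : Finset ℤ³, S = (freqBall K).erase 0 →
        ∃ c : ℝ → ↥S → ℂ³, IsCoeffTrajectory S (ν j) g c ∧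
          longTimeAvgSup (coeffEnergy c) ≤ E ∧ ε ≤ longTimeAvgInf (coeffDissipation (ν j) c) := by
  rintro ⟨N, g, hg, E, ε, hε, ν, hν, hlim, K₀, hK⟩
  have hj : ∀ j, ε ≤ ν j * (4 * Real.pi ^ 2 * (K₀ : ℝ) ^ 2 * E) := by
    intro j
    obtain ⟨c, hc, hE, hD⟩ := hK j K₀ le_rfl _ rfl
    have h := (heart_budget_necessary hg (hν j) rfl hc hE hD).2
    calc ε ≤ 4 * Real.pi ^ 2 * (K₀ : ℝ) ^ 2 * ν j * E := h
      _ = ν j * (4 * Real.pi ^ 2 * (K₀ : ℝ) ^ 2 * E) := by ring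
  have hlim' : Tendsto (fun j => ν j * (4 * Real.pi ^ 2 * (K₀ : ℝ) ^ 2 * E)) atTop (nhds 0) := by
    simpa using hlim.mul_const (4 * Real.pi ^ 2 * (K₀ : ℝ) ^ 2 * E)
  have hε0 : ε ≤ 0 := ge_of_tendsto' hlim' hj
  linarith

/-! ## The registered Tools stub -/

/-- **Registered Tools stub `stub_heartBudgetTools`** (crux stmt-AnomalousDissipation-1582, line
`birth`; STUB-PLAN Step 0′): T8 (truncation ceiling) ∧ floor-vs-ceiling ∧ N2 (witness budgets) ∧
N1 (the `∃ K₀ ∀ j` strengthening is false), in the skeleton's vocabulary, signature registered verbatim. -/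
theorem stub_heartBudgetTools :
    (∀ (K : ℕ) (S : Finset ℤ³), S ⊆ freqBall K → ∀ ν : ℝ, 0 ≤ ν → ∀ (c : ℝ → ↥S → ℂ³) (t : ℝ), coeffDissipation ν c t ≤ ν * (4 * Real.pi ^ 2 * (K : ℝ) ^ 2) * coeffEnergy c t) ∧ (∀ (K : ℕ) (S : Finset ℤ³), (∀ k ∈ S, -k ∈ S) → (0 : ℤ³) ∉ S → S ⊆ freqBall K → ∀ ν : ℝ, 0 < ν → ∀ g : ℤ³ → ℂ³, IsConjSymm g → ∀ c : ℝ → ↥S → ℂ³, IsCoeffTrajectory S ν g c → longTimeAvgInf (coeffDissipation ν c) ≤ ν * (4 * Real.pi ^ 2 * (K : ℝ) ^ 2) * longTimeAvgSup (coeffEnergy c)) ∧ (∀ (N : ℕ) (g : ℤ³ → ℂ³), IsDesignerForce N g → ∀ ν : ℝ, 0 < ν → ∀ (K : ℕ) (S : Finset ℤ³), S = (freqBall K).erase 0 → ∀ c : ℝ → ↥S → ℂ³, IsCoeffTrajectory S ν g c → ∀ E ε : ℝ, longTimeAvgSup (coeffEnergy c) ≤ E → ε ≤ longTimeAvgInf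 (coeffDissipation ν c) → ε ≤ Real.sqrt (∑ k ∈ freqBall N, ‖g k‖ ^ 2) * Real.sqrt E ∧ ε ≤ 4 * Real.pi ^ 2 * (K : ℝ) ^ 2 * ν * E) ∧ (¬ ∃ (N : ℕ) (g : ℤ³ → ℂ³), IsDesignerForce N g ∧ ∃ (E ε : ℝ), 0 < ε ∧ ∃ ν : ℕ → ℝ, (∀ j, 0 < ν j) ∧ Tendsto ν atTop (nhds 0) ∧ ∃ K₀ : ℕ, ∀ j, ∀ K, K₀ ≤ K → ∀ S : Finset ℤ³, S = (freqBall K).erase 0 → ∃ c : ℝ → ↥S → ℂ³, IsCoeffTrajectory S (ν j) g c ∧ longTimeAvgSup (coeffEnergy c) ≤ E ∧ ε ≤ longTimeAvgInf (coeffDissipation (ν j) c)) :=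
  ⟨fun _ _ hSK _ hν c t => dissipation_le_of_subset_freqBall hSK hν (c t),
    fun _ _ hS h0 hSK _ hν _ hg _ hc => longTimeAvgInf_coeffDissipation_le hS h0 hSK hν hg hc,
    fun _ _ hg _ hν _ _ hS _ hc _ _ hE hε => heart_budget_necessary hg hν hS hc hE hε,
    not_heart_with_uniform_threshold⟩

end Summit.AnomalousDissipation.AnomalousDissipation.Theorems.DecimationAxisGalerkinFloor

end
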